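import Summits.Ventures.LatticeQCDFlow.Scaling.TaggedPerStepDomination
import Summits.Ventures.LatticeQCDFlow.Scaling.TaggedHubLumping

/-!
HONEST FRAMING: exact (Metropolis-corrected) sampling algorithms for lattice gauge theory; figures
of merit are autocorrelation/cost numbers at stated couplings and volumes; no continuum-physics
claim.

# TaggedPerStepGain — THE PER-ATTEMPT-COUNT GAIN OF AN ADJACENT PAIR LOSES EXACTLY THE START-CONTENT DEFICIT: `G_j = x_j(★) + (x_j(a) − y_j(a)) − 𝟙{z ∉ {a,b}}·(y_j(z) − x_j(z))⁺`
# (lean-2 GEN-40, ours)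

Venture-side (OURS).  Cell `lqcd-flow` (pub-lqcd), unit `pub-lqcd-lean-2-g40`, 2026-08-30.  Chapter Z, file 8.  Setting of W15∕W26∕Z4: tagged chains `PX` (tag `a`), `PY` (tag `b`) on
`Option S` for the ordinary composition `NC` (`ΣNC = K`), `W_b ≤ W_a`, the `j`-attempt hub laws `x_j, y_j` from a common ordinary hub content `z`, the full compositions `N_X = NC + δ_a`,
`N_Y = NC + δ_b` and the lumped laws `u^X_j = cont_*x_j`, `u^Y_j = cont_*y_j`.  W15 `adjacent_gain_eq` (stated for ANY pair of laws) gives the gain functional of route (β)'s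
clock-conditioned coupling at attempt count `j` as `x_j(★) + (x_j(a) − y_j(a)) − Σ_{w∉{a,b}}(y_j(w) − x_j(w))⁺`; by Z4 (`tagged_perStep_domination`) every penalty term with `w ≠ z`
vanishes, and absent contents carry no mass (`tagged_law_absent`).  Hence:

* `tagged_law_absent`: `NC(w) = 0 ⇒ x_j(w) = 0`;
* `tagged_perStep_penalty`: `Σ_{w∉{a,b}}(y_j(w) − x_j(w))⁺ = 𝟙{z ∉ {a,b}}·(y_j(z) − x_j(z))⁺` — the START-CONTENT DEFICIT of MEMO-gen40 §4, and nothing else;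
* **`tagged_perStep_gain_eq`**: `G_j = x_j(★) + (x_j(a) − y_j(a)) − 𝟙{z ∉ {a,b}}(y_j(z) − x_j(z))⁺`, with `x_j(a) − y_j(a) ≥ 0` when `z ≠ a` (`tagged_perStep_gain_ge`:
  `G_j ≥ x_j(★) − 𝟙{z ∉ {a,b}}(y_j(z) − x_j(z))⁺`).

With Z5 (the deficit is `0` for odd `j` and `≤ K⁻ʲ`) and Z6∕Z7 (it is `≤ x_j(★)` when no class separates the two tags) this is the per-`j` input of the discounted certificate
`Σ_jw_jQ_j = L(x̃(a)−ỹ(a)) + 2s₁ + s₂ + s₃ − L·D` (MEMO-gen40 §4).  Literature grade (cell rule): OWN, plumbing; nothing cited; no new bib keys.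
-/

open Finset

namespace Summit.Ventures.LatticeQCDFlow.Scaling

section PerStepGain
variable {S : Type*} [Fintype S] [DecidableEq S]
variable {W : S → ℝ} {acc : S → S → ℝ} {K : ℕ} {NC NX NY : S → ℕ} {a b : S} {PX PY : Option S → Option S → ℝ}

/-- **Absent contents carry no mass** under the `j`-attempt laws from a present hub. [ours] -/
theorem tagged_law_absent {P : Option S → Option S → ℝ} {tag : S}
    (hPoff : ∀ h v, h ≠ v → P (some h) (some v) = if NC h = 0 then 0 else (NC v : ℝ) / K * acc h v)
    (hPout : ∀ v, P none (some v) = (NC v : ℝ) / K * acc tag v)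
    {z : S} (hz : NC z ≠ 0) {x : ℕ → Option S → ℝ}
    (hx0 : ∀ v, x 0 v = if v = some z then 1 else 0) (hxs : ∀ n v, x (n + 1) v = ∑ h, x n h * P h v)
    {w : S} (hw : NC w = 0) : ∀ n, x n (some w) = 0 := by
  intro n
  induction n with
  | zero => rw [hx0, if_neg (fun h => hz (by rw [Option.some_injective _ h] at hw; exact hw))]
  | succ n ih =>
      rw [hxs]
      refine sum_eq_zero fun h _ => ?_
      rcases h with _ | h
      · rw [hPout, hw]; simp
      · by_cases hhw : h = w
        · subst hhw; rw [ih, zero_mul]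
        · rw [hPoff h w hhw, hw]; simp

/-- **The penalty of the per-`j` gain is the start-content deficit:** `Σ_{w∉{a,b}}(y_j(w) − x_j(w))⁺ = 𝟙{z ∉ {a,b}}(y_j(z) − x_j(z))⁺`. [ours] -/
theorem tagged_perStep_penalty (hW : ∀ v, 0 < W v) (hacc : ∀ h v, acc h v = min 1 (W h / W v)) (hK : 1 ≤ K) (hNC : ∑ v, NC v = K) (hab : W b ≤ W a)
    (hPXoff : ∀ h v, h ≠ v → PX (some h) (some v) = if NC h = 0 then 0 else (NC v : ℝ) / K * acc h v)
    (hPXin : ∀ h, PX (some h) none = if NC h = 0 then 0 else acc h a / K)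
    (hPXdiag : ∀ h, PX (some h) (some h) = 1 - (∑ v ∈ univ.erase h, PX (some h) (some v) + PX (some h) none))
    (hPXout : ∀ v, PX none (some v) = (NC v : ℝ) / K * acc a v) (hPXstay : PX none none = 1 - ∑ v, PX none (some v))
    (hPYoff : ∀ h v, h ≠ v → PY (some h) (some v) = if NC h = 0 then 0 else (NC v : ℝ) / K * acc h v)
    (hPYin : ∀ h, PY (some h) none = if NC h = 0 then 0 else acc h b / K)
    (hPYdiag : ∀ h, PY (some h) (some h) = 1 - (∑ v ∈ univ.erase h, PY (some h) (some v) + PY (some h) none))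
    (hPYout : ∀ v, PY none (some v) = (NC v : ℝ) / K * acc b v) (hPYstay : PY none none = 1 - ∑ v, PY none (some v))
    {z : S} (hz : NC z ≠ 0) {x y : ℕ → Option S → ℝ}
    (hx0 : ∀ v, x 0 v = if v = some z then 1 else 0) (hxs : ∀ n v, x (n + 1) v = ∑ h, x n h * PX h v)
    (hy0 : ∀ v, y 0 v = if v = some z then 1 else 0) (hys : ∀ n v, y (n + 1) v = ∑ h, y n h * PY h v) (n : ℕ) :
    ∑ w, (if w ≠ a ∧ w ≠ b then max (y n (some w) - x n (some w)) 0 else (0 : ℝ))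
      = if z ≠ a ∧ z ≠ b then max (y n (some z) - x n (some z)) 0 else 0 := by
  rw [Finset.sum_eq_single z]
  · intro w _ hwz
    by_cases h : (w ≠ a ∧ w ≠ b)
    · rw [if_pos h]
      by_cases hw : NC w = 0
      · rw [tagged_law_absent hPXoff hPXout hz hx0 hxs hw n, tagged_law_absent hPYoff hPYout hz hy0 hys hw n]; simp
      · have hd := tagged_perStep_domination hW hacc hK hNC hab hPXoff hPXin hPXdiag hPXout hPXstay hPYoff hPYin hPYdiag hPYout hPYstay hz hx0 hxs hy0 hys n hwz hw
        exact max_eq_right (by linarith)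
    · rw [if_neg h]
  · intro h; exact absurd (mem_univ z) h

/-- **THE PER-`j` GAIN OF AN ADJACENT PAIR:** with the lumped laws `u^X = cont_*x_j`, `u^Y = cont_*y_j`,
`G(u^X,u^Y) = x_j(★) + (x_j(a) − y_j(a)) − 𝟙{z ∉ {a,b}}(y_j(z) − x_j(z))⁺`. [ours] -/
theorem tagged_perStep_gain_eq (hW : ∀ v, 0 < W v) (hacc : ∀ h v, acc h v = min 1 (W h / W v)) (hK : 1 ≤ K) (hNC : ∑ v, NC v = K) (hab : W b ≤ W a) (hab' : a ≠ b)
    (hX : NX = NC + Pi.single a 1) (hY : NY = NC + Pi.single b 1)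
    (hPXoff : ∀ h v, h ≠ v → PX (some h) (some v) = if NC h = 0 then 0 else (NC v : ℝ) / K * acc h v)
    (hPXin : ∀ h, PX (some h) none = if NC h = 0 then 0 else acc h a / K)
    (hPXdiag : ∀ h, PX (some h) (some h) = 1 - (∑ v ∈ univ.erase h, PX (some h) (some v) + PX (some h) none))
    (hPXout : ∀ v, PX none (some v) = (NC v : ℝ) / K * acc a v) (hPXstay : PX none none = 1 - ∑ v, PX none (some v))
    (hPYoff : ∀ h v, h ≠ v → PY (some h) (some v) = if NC h = 0 then 0 else (NC v : ℝ) / K * acc h v)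
    (hPYin : ∀ h, PY (some h) none = if NC h = 0 then 0 else acc h b / K)
    (hPYdiag : ∀ h, PY (some h) (some h) = 1 - (∑ v ∈ univ.erase h, PY (some h) (some v) + PY (some h) none))
    (hPYout : ∀ v, PY none (some v) = (NC v : ℝ) / K * acc b v) (hPYstay : PY none none = 1 - ∑ v, PY none (some v))
    {z : S} (hz : NC z ≠ 0) {x y : ℕ → Option S → ℝ}
    (hx0 : ∀ v, x 0 v = if v = some z then 1 else 0) (hxs : ∀ n v, x (n + 1) v = ∑ h, x n h * PX h v)
    (hy0 : ∀ v, y 0 v = if v = some z then 1 else 0) (hys : ∀ n v, y (n + 1) v = ∑ h, y n h * PY h v) (n : ℕ)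
    {utX utY : S → ℝ} (hlX : ∀ w, utX w = x n (some w) + (if w = a then x n none else 0)) (hlY : ∀ w, utY w = y n (some w) + (if w = b then y n none else 0)) :
    ∑ w, utX w * (if NY w < NX w then (1 : ℝ) else 0) - ∑ w, utY w * (if NY w < NX w then (1 : ℝ) else 0)
        - ∑ w, max (utY w - utX w) 0 * (if NX w = NY w then (1 : ℝ) else 0)
      = x n none + (x n (some a) - y n (some a)) - (if z ≠ a ∧ z ≠ b then max (y n (some z) - x n (some z)) 0 else 0) := by
  rw [adjacent_gain_eq hX hY hab' hlX hlY, tagged_perStep_penalty hW hacc hK hNC hab hPXoff hPXin hPXdiag hPXout hPXstay hPYoff hPYin hPYdiag hPYout hPYstay hz hx0 hxs hy0 hys n]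

/-- **Corollary:** `G_j ≥ x_j(★) − 𝟙{z ∉ {a,b}}(y_j(z) − x_j(z))⁺`, the gap at content `a` being non-negative (Z4; for `z = a` it is the `a`-term of the lumped law, absorbed). [ours] -/
theorem tagged_perStep_gain_ge (hW : ∀ v, 0 < W v) (hacc : ∀ h v, acc h v = min 1 (W h / W v)) (hK : 1 ≤ K) (hNC : ∑ v, NC v = K) (hab : W b ≤ W a) (hab' : a ≠ b)
    (hX : NX = NC + Pi.single a 1) (hY : NY = NC + Pi.single b 1)
    (hPXoff : ∀ h v, h ≠ v → PX (some h) (some v) = if NC h = 0 then 0 else (NC v : ℝ) / K * acc h v)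
    (hPXin : ∀ h, PX (some h) none = if NC h = 0 then 0 else acc h a / K)
    (hPXdiag : ∀ h, PX (some h) (some h) = 1 - (∑ v ∈ univ.erase h, PX (some h) (some v) + PX (some h) none))
    (hPXout : ∀ v, PX none (some v) = (NC v : ℝ) / K * acc a v) (hPXstay : PX none none = 1 - ∑ v, PX none (some v))
    (hPYoff : ∀ h v, h ≠ v → PY (some h) (some v) = if NC h = 0 then 0 else (NC v : ℝ) / K * acc h v)
    (hPYin : ∀ h, PY (some h) none = if NC h = 0 then 0 else acc h b / K)
    (hPYdiag : ∀ h, PY (some h) (some h) = 1 - (∑ v ∈ univ.erase h, PY (some h) (some v) + PY (some h) none))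
    (hPYout : ∀ v, PY none (some v) = (NC v : ℝ) / K * acc b v) (hPYstay : PY none none = 1 - ∑ v, PY none (some v))
    {z : S} (hz : NC z ≠ 0) (hza : z ≠ a) {x y : ℕ → Option S → ℝ}
    (hx0 : ∀ v, x 0 v = if v = some z then 1 else 0) (hxs : ∀ n v, x (n + 1) v = ∑ h, x n h * PX h v)
    (hy0 : ∀ v, y 0 v = if v = some z then 1 else 0) (hys : ∀ n v, y (n + 1) v = ∑ h, y n h * PY h v) (n : ℕ)
    {utX utY : S → ℝ} (hlX : ∀ w, utX w = x n (some w) + (if w = a then x n none else 0)) (hlY : ∀ w, utY w = y n (some w) + (if w = b then y n none else 0)) :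
    x n none - (if z ≠ a ∧ z ≠ b then max (y n (some z) - x n (some z)) 0 else 0)
      ≤ ∑ w, utX w * (if NY w < NX w then (1 : ℝ) else 0) - ∑ w, utY w * (if NY w < NX w then (1 : ℝ) else 0)
        - ∑ w, max (utY w - utX w) 0 * (if NX w = NY w then (1 : ℝ) else 0) := by
  rw [tagged_perStep_gain_eq hW hacc hK hNC hab hab' hX hY hPXoff hPXin hPXdiag hPXout hPXstay hPYoff hPYin hPYdiag hPYout hPYstay hz hx0 hxs hy0 hys n hlX hlY]
  have hgap : y n (some a) ≤ x n (some a) := by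
    by_cases ha : NC a = 0
    · rw [tagged_law_absent hPXoff hPXout hz hx0 hxs ha n, tagged_law_absent hPYoff hPYout hz hy0 hys ha n]
    · exact tagged_perStep_domination hW hacc hK hNC hab hPXoff hPXin hPXdiag hPXout hPXstay hPYoff hPYin hPYdiag hPYout hPYstay hz hx0 hxs hy0 hys n hza.symm ha
  linarith

end PerStepGain

end Summit.Ventures.LatticeQCDFlow.Scaling
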